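import Mathlib.Analysis.Matrix.Normed
import Mathlib.Analysis.Normed.Algebra.MatrixExponential
import Mathlib.Analysis.SpecialFunctions.Exponential
import Mathlib.Analysis.Calculus.MeanValue
import Literature.NumberTheory.Automorphic.AutomorphicRepsGLOneLine
import Literature.NumberTheory.Automorphic.AutomorphicFormsStableCenter
import Literature.NumberTheory.Automorphic.AutomorphyDatumGLRegular
import HarnessLib

/-!
# A finite-dimensional space of smooth functions stable under `X ∈ 𝔤` is stable under the
# one-parameter subgroup `exp(tX)`; the archimedean group acts on automorphic representations
# of `GL₁(𝔸_K)` by scalars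

Topic `NumberTheory/Automorphic`; proof file (theorems only: no definition, no named fact, no
instance), third step (after `AutomorphicRepsGLOneLine`, `AutomorphicRepsGLOneArchParameter`) of
the rank-one case of the named fact `ArthurClozel1989_strongLifting_archimedean`
(`BaseChangeArchimedean`; Arthur–Clozel (1989), Ch. 3, Thm. 5.1 with Ch. 1 §7), in the vocabulary
of `ArchimedeanCalculus` (`IsArchSmooth`, `lieDeriv`, `archTranslate`, `zOrbitSpan`) and
`AutomorphicForms` (`IsStableSubmodule`, `AutomorphicRepData`, `rightTranslation`).

* `exists_matrix_archTranslate_expMem_eq_sum` — **the linear ODE along a one-parameter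
  subgroup.** Let `V` be a finite-dimensional space of functions `G → ℂ`, smooth in the
  archimedean variable and stable under the Lie derivative along `X ∈ 𝔤`, with basis `b₁, …, b_m`
  (`Module.finBasis`) and `X bᵢ = ∑ⱼ Mᵢⱼ bⱼ`. Then `r(exp tX) bᵢ = ∑ⱼ (e^{tM})ᵢⱼ bⱼ`: the vector
  `u_g(t) = (bᵢ(g · ι(exp tX)))ᵢ` solves `u' = M u` (`IsArchSmooth.hasDerivAt_flow`), and
  `t ↦ e^{-tM} u_g(t)` has derivative zero (Mathlib `hasDerivAt_exp_smul_const`,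
  `is_const_of_deriv_eq_zero`, `Matrix.exp_add_of_commute`). Hence
  `archTranslate_expMem_mem_of_lieDeriv_mem`: **`V` is stable under `r(exp tX)`** (Borel 1997,
  8.6; Harish-Chandra 1953, proof of the Corollary to Thm. 2: a `𝔤`-stable finite-dimensional
  space of analytic vectors is stable under the identity component).
* For the `GL₁` datum (`𝔤 = 𝔤𝔩₁(K_∞)` abelian, so every `X` is central and preserves the
  `Z(𝔤)`-orbit span of a form, `lieDeriv_mem_zOrbitSpan_of_forall_lie_eq_zero`):
  `IsStableSubmodule.rightTranslation_ofArch_expMem_mem_glOne` and, with the Cartan decomposition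
  `GL₁(K_∞) = K_∞ · exp 𝔭` (`AutomorphyDatum.isRegular_gl`),
  `IsStableSubmodule.rightTranslation_ofArch_mem_glOne` — **every `(𝔤, K_∞) × GL₁(𝔸_K^∞)`-stable
  space of automorphic forms on `GL₁(𝔸_K)` is stable under the whole of `GL₁(K_∞)`**, hence under
  all of `GL₁(𝔸_K)` (`IsStableSubmodule.rightTranslation_mem_glOne`, via `g = g_∞ g_f`,
  `GLn.ofInfinite_toMixed_mul_ofFinite_sndHom`).
* `AutomorphicRepData.exists_rightTranslation_sub_smul_mem_glOne'` — **every `g ∈ GL₁(𝔸_K)` acts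
  on `W / W'` by a scalar** for every automorphic representation `π = W / W'` of `GL₁(𝔸_K)`
  (Schur modulo `W'`, `AutomorphicRepData.exists_forall_sub_smul_mem_of_comm`): the quasi-character
  `χ_π : GL₁(𝔸_K) → ℂˣ` of `π` (Gelbart 1975, §2.A), studied in the sequel files.

## References

* A. Borel, *Automorphic forms on `SL₂(ℝ)`*, Cambridge Tracts in Math. 130 (1997), 8.6 [Borel1997].
* Harish-Chandra, *Representations of a semisimple Lie group on a Banach space. I*, Trans. AMS 75
  (1953), Cor. to Thm. 2 [HarishChandraTAMS1953].
* S. Gelbart, *Automorphic forms on adele groups*, Ann. of Math. Stud. 83 (1975), §2.A [Gelbart1975].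
* A. Borel, H. Jacquet, Corvallis (1979), Part 1, §4.6, 5.7 [BorelJacquet1979].
* J. Arthur, L. Clozel, Ann. of Math. Stud. 120 (1989), Ch. 3 §4, Thm. 5.1 [ArthurClozelAMS120].
-/

noncomputable section

open scoped MatrixGroups Matrix Classical
open NumberField NumberField.mixedEmbedding IsDedekindDomain NormedSpace

namespace Literature.NumberTheory.Automorphic

/-! ### The linear ODE along a one-parameter subgroup -/

section ODE

variable {A : Type*} [NormedCommRing A] [NormedAlgebra ℝ A] [NormedAlgebra ℚ A] [CompleteSpace A]
  [StarRing A] {N : Type*} [Fintype N] [DecidableEq N] {H : RealMatrixGroup A N}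
  {G : Type*} [Group G] (ι : H.carrier →* G)

/-- **Entries of `t ↦ e^{tM}` are differentiable**, with derivative the entries of `e^{tM} M`
(Mathlib `hasDerivAt_exp_smul_const` for the `L^∞` operator norm on complex matrices, composed with
the entry functional). [folklore] -/
theorem hasDerivAt_exp_smul_apply {m : ℕ} (M : Matrix (Fin m) (Fin m) ℂ) (t : ℝ) (i j : Fin m) :
    HasDerivAt (fun s : ℝ => exp (s • M) i j) ((exp (t • M) * M) i j) t := by
  letI : NormedRing (Matrix (Fin m) (Fin m) ℂ) := Matrix.linftyOpNormedRing
  letI : NormedAlgebra ℝ (Matrix (Fin m) (Fin m) ℂ) := Matrix.linftyOpNormedAlgebra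
  let e : Matrix (Fin m) (Fin m) ℂ →L[ℝ] ℂ :=
    LinearMap.toContinuousLinearMap (Matrix.entryLinearMap ℝ ℂ i j)
  exact e.hasFDerivAt.comp_hasDerivAt t (hasDerivAt_exp_smul_const M t)

/-- `M` commutes with `e^{tM}`. [folklore] -/
theorem mul_exp_smul_comm {m : ℕ} (M : Matrix (Fin m) (Fin m) ℂ) (t : ℝ) :
    M * exp (t • M) = exp (t • M) * M :=
  ((Commute.refl M).smul_right t).exp_right.eq

/-- **Constant-coefficient linear systems are solved by the matrix exponential** (uniqueness form):
if `u : ℝ → ℂ^m` satisfies `u'(t) = M u(t)` for all `t`, then `u(t) = e^{tM} u(0)` — the function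
`t ↦ e^{-tM} u(t)` has derivative `0`. Hartman, *Ordinary Differential Equations*, IV.5. [folklore] -/
theorem eq_exp_mulVec_of_hasDerivAt_mulVec {m : ℕ} (M : Matrix (Fin m) (Fin m) ℂ) {u : ℝ → Fin m → ℂ}
    (hu : ∀ t, HasDerivAt u (M *ᵥ u t) t) (t : ℝ) : u t = exp (t • M) *ᵥ u 0 := by
  letI : NormedRing (Matrix (Fin m) (Fin m) ℂ) := Matrix.linftyOpNormedRing
  letI : NormedAlgebra ℝ (Matrix (Fin m) (Fin m) ℂ) := Matrix.linftyOpNormedAlgebra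
  -- `P s = e^{-sM}` and its entries
  set P : ℝ → Matrix (Fin m) (Fin m) ℂ := fun s => exp (s • (-M)) with hP_def
  have hP : ∀ s, HasDerivAt P (exp (s • (-M)) * (-M)) s := fun s => hasDerivAt_exp_smul_const (-M) s
  have hPij : ∀ (s : ℝ) (i j : Fin m),
      HasDerivAt (fun s => P s i j) ((exp (s • (-M)) * (-M)) i j) s := by
    intro s i j
    let e : Matrix (Fin m) (Fin m) ℂ →L[ℝ] ℂ :=
      LinearMap.toContinuousLinearMap (Matrix.entryLinearMap ℝ ℂ i j)
    have := e.hasFDerivAt.comp_hasDerivAt s (hP s)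
    exact this
  -- `W s = P s *ᵥ u s` has derivative zero
  set W : ℝ → Fin m → ℂ := fun s => P s *ᵥ u s with hW_def
  have hW : ∀ s, HasDerivAt W 0 s := by
    intro s
    have h1 : HasDerivAt W ((exp (s • (-M)) * (-M)) *ᵥ u s + P s *ᵥ (M *ᵥ u s)) s := by
      rw [hasDerivAt_pi]
      intro i
      have hsum : ∀ s', W s' i = ∑ j, P s' i j * u s' j := fun s' => rfl
      simp only [hsum]
      have := HasDerivAt.sum (u := Finset.univ)
        (A := fun j s' => P s' i j * u s' j)
        (A' := fun j => (exp (s • (-M)) * (-M)) i j * u s j + P s i j * (M *ᵥ u s) j)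
        (x := s) (fun j _ => (hPij s i j).mul ((hasDerivAt_pi.1 (hu s)) j))
      convert this using 1
      · funext s'; simp
      · simp only [Pi.add_apply, Matrix.mulVec, dotProduct, Finset.sum_add_distrib]
    have h0 : (exp (s • (-M)) * (-M)) *ᵥ u s + P s *ᵥ (M *ᵥ u s) = 0 := by
      rw [Matrix.mulVec_mulVec, ← Matrix.add_mulVec, hP_def]
      simp only [mul_neg, neg_add_cancel, Matrix.zero_mulVec]
    rw [h0] at h1
    exact h1
  have hWconst : W t = W 0 :=
    is_const_of_deriv_eq_zero (fun s => (hW s).differentiableAt) (fun s => (hW s).deriv) t 0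
  have hW0 : W 0 = u 0 := by
    simp only [hW_def, hP_def, zero_smul, exp_zero, Matrix.one_mulVec]
  -- invert `e^{-tM}`
  have hcomm : Commute (t • M) (t • (-M)) :=
    (((Commute.refl M).neg_right).smul_right t).smul_left t
  calc u t = exp (t • M + t • (-M)) *ᵥ u t := by
        rw [smul_neg, add_neg_cancel, exp_zero, Matrix.one_mulVec]
    _ = exp (t • M) *ᵥ W t := by
        rw [Matrix.exp_add_of_commute _ _ hcomm, ← Matrix.mulVec_mulVec]
    _ = exp (t • M) *ᵥ u 0 := by rw [hWconst, hW0]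

/-- **The linear ODE along a one-parameter subgroup, for a `X`-stable finite-dimensional space of
smooth functions.** Let `V` be a finite-dimensional complex space of functions `G → ℂ` smooth in
the archimedean variable and stable under the Lie derivative along `X ∈ 𝔤`; let `b` be its basis
`Module.finBasis ℂ V` and `X bᵢ = ∑ⱼ Mᵢⱼ bⱼ`. Then `r(ι(exp tX)) bᵢ = ∑ⱼ (e^{tM})ᵢⱼ bⱼ` for all
`t` (the slices `u_g(t) = (bᵢ(g ι(exp tX)))ᵢ` solve `u' = M u`, `IsArchSmooth.hasDerivAt_flow`).
Borel 1997, 8.6; Harish-Chandra 1953, Cor. to Thm. 2. [cite: Borel1997, 8.6] -/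
theorem exists_matrix_archTranslate_expMem_eq_sum (V : Submodule ℂ (G → ℂ)) [FiniteDimensional ℂ V]
    (hsmooth : ∀ ψ ∈ V, IsArchSmooth ι ψ) (X : H.lie) (hX : ∀ ψ ∈ V, lieDeriv ι X ψ ∈ V) :
    ∃ M : Matrix (Fin (Module.finrank ℂ V)) (Fin (Module.finrank ℂ V)) ℂ,
      (∀ i, lieDeriv ι X (Module.finBasis ℂ V i : G → ℂ) =
        ∑ j, M i j • (Module.finBasis ℂ V j : G → ℂ)) ∧
      ∀ (t : ℝ) (i : Fin (Module.finrank ℂ V)),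
        archTranslate ι (H.expMem (t • X)) (Module.finBasis ℂ V i : G → ℂ) =
          ∑ j, exp (t • M) i j • (Module.finBasis ℂ V j : G → ℂ) := by
  set b := Module.finBasis ℂ V with hb
  -- the matrix of `X` on `V`
  let D : Fin (Module.finrank ℂ V) → V := fun i => ⟨lieDeriv ι X (b i), hX _ (b i).2⟩
  let M : Matrix (Fin (Module.finrank ℂ V)) (Fin (Module.finrank ℂ V)) ℂ := fun i j => b.repr (D i) j
  have hM : ∀ i, lieDeriv ι X (b i : G → ℂ) = ∑ j, M i j • (b j : G → ℂ) := by
    intro i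
    have h := congrArg (fun v : V => (v : G → ℂ)) (b.sum_repr (D i))
    simp only [AddSubmonoidClass.coe_finsetSum, SetLike.val_smul] at h
    exact h.symm
  have hMpt : ∀ i (p : G), lieDeriv ι X (b i : G → ℂ) p = ∑ j, M i j * (b j : G → ℂ) p := by
    intro i p
    have := congrFun (hM i) p
    simpa only [Finset.sum_apply, Pi.smul_apply, smul_eq_mul] using this
  refine ⟨M, hM, fun t i => ?_⟩
  funext g
  -- the slice through `g`
  set u : ℝ → Fin (Module.finrank ℂ V) → ℂ := fun s j => (b j : G → ℂ) (g * ι (H.expMem (s • X)))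
    with hu_def
  have hu : ∀ s, HasDerivAt u (M *ᵥ u s) s := by
    intro s
    rw [hasDerivAt_pi]
    intro j
    have h := (hsmooth _ (b j).2).hasDerivAt_flow ι X g s
    rw [hMpt] at h
    exact h
  have key := congrFun (eq_exp_mulVec_of_hasDerivAt_mulVec M hu t) i
  simp only [hu_def, zero_smul, RealMatrixGroup.expMem_zero', map_one, mul_one, Matrix.mulVec,
    dotProduct] at key
  rw [archTranslate_apply, key, Finset.sum_apply]
  simp only [Pi.smul_apply, smul_eq_mul]

/-- **A finite-dimensional `X`-stable space of smooth functions is stable under `r(exp tX)`.**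
Borel 1997, 8.6; Harish-Chandra 1953, Cor. to Thm. 2. [cite: Borel1997, 8.6] -/
theorem archTranslate_expMem_mem_of_lieDeriv_mem (V : Submodule ℂ (G → ℂ)) [FiniteDimensional ℂ V]
    (hsmooth : ∀ ψ ∈ V, IsArchSmooth ι ψ) (X : H.lie) (hX : ∀ ψ ∈ V, lieDeriv ι X ψ ∈ V)
    {φ : G → ℂ} (hφ : φ ∈ V) (t : ℝ) :
    archTranslate ι (H.expMem (t • X)) φ ∈ V := by
  obtain ⟨M, -, hM⟩ := exists_matrix_archTranslate_expMem_eq_sum ι V hsmooth X hX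
  set b := Module.finBasis ℂ V
  have hφsum : φ = ∑ i, b.repr ⟨φ, hφ⟩ i • (b i : G → ℂ) := by
    have h := congrArg (fun v : V => (v : G → ℂ)) (b.sum_repr ⟨φ, hφ⟩)
    simp only [AddSubmonoidClass.coe_finsetSum, SetLike.val_smul] at h
    exact h.symm
  rw [hφsum, map_sum]
  refine V.sum_mem fun i _ => ?_
  rw [map_smul]
  refine V.smul_mem _ ?_
  rw [hM t i]
  exact V.sum_mem fun j _ => V.smul_mem _ (b j).2

end ODE

/-! ### `GL₁`: stable spaces of automorphic forms are stable under all of `GL₁(𝔸_K)` -/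

section GLOne

variable {K : Type} [Field K] [NumberField K] {hcpt : isCompact_glFiniteIntegralLevel 1 K}

/-- **Stable spaces of automorphic forms on `GL₁(𝔸_K)` are stable under the one-parameter
subgroups of `GL₁(K_∞)`**: for `W` a `(𝔤, K_∞) × GL₁(𝔸_K^∞)`-stable space of automorphic forms,
`X ∈ 𝔤𝔩₁(K_∞)` and `φ ∈ W`, `r(exp tX) φ ∈ W`. (`𝔤` is abelian, so `X` preserves the
finite-dimensional `Z(𝔤)`-orbit span of `φ`, which is contained in `W` and consists of smooth
functions; apply `archTranslate_expMem_mem_of_lieDeriv_mem`.) Borel–Jacquet 1979, 4.6 and 5.7;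
Borel 1997, 8.6. [cite: Borel1997, 8.6] -/
theorem IsStableSubmodule.rightTranslation_ofArch_expMem_mem_glOne
    {W : Submodule ℂ ((AdelicGroupData.gl 1 K).Adelic → ℂ)}
    (hW : IsStableSubmodule (AutomorphyDatum.gl 1 K hcpt) W) (X : (AutomorphyDatum.gl 1 K hcpt).arch.lie)
    (t : ℝ) {φ : (AdelicGroupData.gl 1 K).Adelic → ℂ} (hφ : φ ∈ W) :
    rightTranslation (AdelicGroupData.gl 1 K)
      ((AutomorphyDatum.gl 1 K hcpt).ofArch ((AutomorphyDatum.gl 1 K hcpt).arch.expMem (t • X))) φ ∈ W := by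
  have hφform : IsAutomorphicForm (AutomorphyDatum.gl 1 K hcpt) φ :=
    isAutomorphicForm_of_mem_automorphicForms_gl (hW.le_automorphicForms hφ)
  have hφs : IsArchSmooth (AutomorphyDatum.gl 1 K hcpt).ofArch φ := hφform.archSmooth
  set V := zOrbitSpan (AutomorphyDatum.gl 1 K hcpt).ofArch φ with hV
  haveI : FiniteDimensional ℂ V := hφform.zFinite
  have hVW : V ≤ W := Submodule.span_le.2 (by
    rintro _ ⟨p, -, rfl⟩
    exact hW.applyFree_mem p hφ)
  have hVs : ∀ ψ ∈ V, IsArchSmooth (AutomorphyDatum.gl 1 K hcpt).ofArch ψ :=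
    fun ψ hψ => isArchSmooth_of_mem_zOrbitSpan _ hφs hψ
  have hVX : ∀ ψ ∈ V, lieDeriv (AutomorphyDatum.gl 1 K hcpt).ofArch X ψ ∈ V :=
    fun ψ hψ => lieDeriv_mem_zOrbitSpan_of_forall_lie_eq_zero _ (glOne_lie_eq_zero X) hφs hψ
  exact hVW (archTranslate_expMem_mem_of_lieDeriv_mem _ V hVs X hVX (mem_zOrbitSpan_self _ φ) t)

/-- **Stable spaces of automorphic forms on `GL₁(𝔸_K)` are stable under all of `GL₁(K_∞)`**
(Cartan decomposition `GL₁(K_∞) = K_∞ · exp 𝔭`, `AutomorphyDatum.isRegular_gl`, together with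
`K_∞`-stability and the one-parameter subgroups). Borel–Jacquet 1979, 4.6. [cite: BorelJacquet1979, 4.6] -/
theorem IsStableSubmodule.rightTranslation_ofArch_mem_glOne
    {W : Submodule ℂ ((AdelicGroupData.gl 1 K).Adelic → ℂ)}
    (hW : IsStableSubmodule (AutomorphyDatum.gl 1 K hcpt) W) (y : (AutomorphyDatum.gl 1 K hcpt).arch.carrier)
    {φ : (AdelicGroupData.gl 1 K).Adelic → ℂ} (hφ : φ ∈ W) :
    rightTranslation (AdelicGroupData.gl 1 K) ((AutomorphyDatum.gl 1 K hcpt).ofArch y) φ ∈ W := by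
  obtain ⟨k, hk, X, hX, -, hy⟩ := (AutomorphyDatum.isRegular_gl hcpt).hasCartanDecomposition y.1 y.2
  have hyk : y = (Subgroup.inclusion (AutomorphyDatum.gl 1 K hcpt).arch.maximalCompact_le_carrier ⟨k, hk⟩) *
      (AutomorphyDatum.gl 1 K hcpt).arch.expMem ((1 : ℝ) • (⟨X, hX⟩ : (AutomorphyDatum.gl 1 K hcpt).arch.lie)) := by
    apply Subtype.ext
    rw [one_smul, Subgroup.coe_mul, RealMatrixGroup.coe_expMem, Subgroup.coe_inclusion, hy]
  rw [hyk, map_mul, map_mul, Module.End.mul_apply]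
  exact hW.k_stable ⟨k, hk⟩ (hW.rightTranslation_ofArch_expMem_mem_glOne ⟨X, hX⟩ 1 hφ)

/-- **Stable spaces of automorphic forms on `GL₁(𝔸_K)` are stable under all of `GL₁(𝔸_K)`**
(`g = g_∞ g_f`, `GLn.ofInfinite_toMixed_mul_ofFinite_sndHom`). Borel–Jacquet 1979, 4.6.
[cite: BorelJacquet1979, 4.6] -/
theorem IsStableSubmodule.rightTranslation_mem_glOne
    {W : Submodule ℂ ((AdelicGroupData.gl 1 K).Adelic → ℂ)}
    (hW : IsStableSubmodule (AutomorphyDatum.gl 1 K hcpt) W) (g : (AdelicGroupData.gl 1 K).Adelic)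
    {φ : (AdelicGroupData.gl 1 K).Adelic → ℂ} (hφ : φ ∈ W) :
    rightTranslation (AdelicGroupData.gl 1 K) g φ ∈ W := by
  have hg : g = (AutomorphyDatum.gl 1 K hcpt).ofArch ⟨GLn.toMixed 1 K g, trivial⟩ *
      (show (AdelicGroupData.gl 1 K).Adelic from GLn.ofFinite 1 K (GLn.sndHom 1 K g)) :=
    (GLn.ofInfinite_toMixed_mul_ofFinite_sndHom (n := 1) (K := K) g).symm
  have hfin : (show (AdelicGroupData.gl 1 K).Adelic from GLn.ofFinite 1 K (GLn.sndHom 1 K g)) ∈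
      (AutomorphyDatum.gl 1 K hcpt).finiteAdelic := by
    rw [AutomorphyDatum.gl_finiteAdelic]
    exact ⟨_, rfl⟩
  rw [hg, map_mul, Module.End.mul_apply]
  exact hW.rightTranslation_ofArch_mem_glOne _ (hW.finite_stable _ hfin hφ)

/-- **Every `g ∈ GL₁(𝔸_K)` acts by a scalar on an automorphic representation `W / W'` of
`GL₁(𝔸_K)`**: `r(g) φ - c φ ∈ W'` for all `φ ∈ W` (`W`, `W'` are `r(g)`-stable by
`IsStableSubmodule.rightTranslation_mem_glOne`, `r(g)` commutes with everything, and Schur's lemma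
modulo `W'` applies, `AutomorphicRepData.exists_forall_sub_smul_mem_of_comm`). This is the
quasi-character `χ_π(g)` of `π` (Gelbart 1975, §2.A: automorphic representations of `GL(1)` are
characters of `𝔸ˣ/Kˣ`). [cite: Gelbart1975, §2.A] -/
theorem AutomorphicRepData.exists_rightTranslation_sub_smul_mem_glOne'
    (π : AutomorphicRepData (AutomorphyDatum.gl 1 K hcpt)) (g : (AdelicGroupData.gl 1 K).Adelic) :
    ∃ c : ℂ, ∀ φ ∈ π.W, rightTranslation (AdelicGroupData.gl 1 K) g φ - c • φ ∈ π.W' :=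
  π.exists_forall_sub_smul_mem_of_comm π.exists_countable_le_sup_span_gl
    (rightTranslation (AdelicGroupData.gl 1 K) g)
    (fun _ hφ => π.stable.rightTranslation_mem_glOne g hφ)
    (fun _ hφ => π.stable'.rightTranslation_mem_glOne g hφ)
    (fun φ _ ψ _ => map_add _ φ ψ) (fun a φ _ => map_smul _ a φ)
    (fun h _ φ _ => rightTranslation_comm_glOne _ h φ)
    (fun _ φ _ => rightTranslation_comm_glOne _ _ φ)
    (fun X φ _ => (lieDeriv_rightTranslation_glOne X _ φ).symm)

end GLOne

end Literature.NumberTheory.Automorphic
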